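import Literature.NumberTheory.EllipticCurves.CanonicalPAdicHeightThetaProofs
import HarnessLib

/-!
# The formal group law at points of the open unit disc: pointwise values, the derivative
# dictionary, and the chart transfer of the chord factorisation (proofs only)

Trunk T-NT-EC (Literature/NumberTheory/EllipticCurves); first of the two proof files discharging
the named fact `WeierstrassCurve.formalGroupLaw_padicEval` (θ₃ of
`CanonicalPAdicHeightThetaProofs.lean`); the case analysis and the discharge itself are in
`FormalGroupLawPadicProofs.lean`, whose module docstring describes the whole architecture. Here:

* formal identities: `derivative_formalWStep`, `derivative_formalW` (implicit differentiation of
  the fixed point `w = f(z, w)`, Silverman AEC IV.1.1), `derivative_map`, and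
  `formalSlope_diag` — **`λ(z, z) = w'(z)`** (the chord slope on the diagonal is the derivative);
* pointwise values at `(u, v)` in the open unit disc of the formal slope, intercept, chord-cubic
  coefficients, third root and group law (`padicEval₂_formalSlope_mul_sub`, `…_formalIntercept`,
  `…_formalChordDenom`, `…_formalChordNum`, `…_formalChordZ`, `…_formalGroupLaw`,
  `…_formalSlope_diag`), all through the evaluation homomorphism of `PadicSeriesEvaluation.lean`;
* the derivative at a point of `E₁(ℚ_p)`: `padicEval_derivative_formalW_eq` and the
  **derivative dictionary** `ŵ'·(z F_x - F_y) = w F_x` (`padicEval_derivative_formalW_mul`);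
* pure field algebra: the chart identity `f(z,w) - w = -w³F(z/w, -1/w)` (`chart_identity`,
  `chart_point`), the chart transfer of Mathlib's chord factorisation to the coefficients of the
  `(z,w)`-cubic (`chord_coeffs_of_xy_factorisation`, via `Polynomial.eq_zero_of_infinite_isRoot`),
  Vieta (`chord_vieta`, `y_ne_zero_of_chord_coeff_ne_zero`), and the chords through the origin
  (`chord_cubic_root`, `chord_origin_vieta`, `chord_origin_double`).

## Sources

* J. H. Silverman, *The Arithmetic of Elliptic Curves*, 2nd ed. (2009), IV.1 pp. 115–118.
-/

noncomputable section

open scoped Classical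
open PowerSeries Literature.NumberTheory.EllipticCurves

namespace WeierstrassCurve

variable {R : Type*} [CommRing R] (W : WeierstrassCurve R)

/-! ### Formal derivatives: `w' = f_z(z, w) + f_w(z, w) · w'` and `λ(z, z) = w'(z)` -/

section FormalDerivative

/-- The derivative of the contraction polynomial along a series `w`:
`d/dz f(z, w) = (3z² + a₁w + 2a₂zw + a₄w²) + (a₁z + a₂z² + 2a₃w + 2a₄zw + 3a₆w²) · w'`.
[Silverman AEC IV.1] [folklore] -/
theorem derivative_formalWStep (w : R⟦X⟧) :
    d⁄dX R (W.formalWStep w) =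
      (3 * X ^ 2 + C W.a₁ * w + 2 * C W.a₂ * X * w + C W.a₄ * w ^ 2) +
        (C W.a₁ * X + C W.a₂ * X ^ 2 + 2 * C W.a₃ * w + 2 * C W.a₄ * X * w + 3 * C W.a₆ * w ^ 2) *
          d⁄dX R w := by
  unfold formalWStep
  simp only [map_add, Derivation.leibniz, Derivation.leibniz_pow, derivative_C, derivative_X,
    smul_eq_mul]
  ring

/-- **Implicit differentiation of the fixed point**: `w' = f_z(z, w) + f_w(z, w) · w'` for
`w = w(z)`. [Silverman AEC IV.1] [folklore] -/
theorem derivative_formalW :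
    d⁄dX R W.formalW =
      (3 * X ^ 2 + C W.a₁ * W.formalW + 2 * C W.a₂ * X * W.formalW + C W.a₄ * W.formalW ^ 2) +
        (C W.a₁ * X + C W.a₂ * X ^ 2 + 2 * C W.a₃ * W.formalW + 2 * C W.a₄ * X * W.formalW +
            3 * C W.a₆ * W.formalW ^ 2) * d⁄dX R W.formalW := by
  conv_lhs => rw [← W.formalWStep_formalW]
  exact W.derivative_formalWStep W.formalW

/-- The derivative commutes with `map`. [folklore] -/
theorem _root_.Literature.NumberTheory.EllipticCurves.derivative_map {S : Type*} [CommRing S]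
    (φ : R →+* S) (f : R⟦X⟧) : d⁄dX S (PowerSeries.map φ f) = PowerSeries.map φ (d⁄dX R f) := by
  ext n
  rw [coeff_derivative, coeff_map, coeff_map, coeff_derivative, map_mul]
  congr 1
  simp

/-- **`λ` on the diagonal is the derivative of `w`**: `λ(z, z) = w'(z)` (read in the variable
`z₁`): the coefficient of `zⁿ` in `Σ_{i+j=n} A_{i+j-2} zⁱzʲ` is `(n+1)·coeff_{n+1} w`.
[Silverman AEC IV.1 (`λ = Σ A_{n-3}(z₂ⁿ - z₁ⁿ)/(z₂ - z₁)`)] [folklore] -/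
theorem formalSlope_diag :
    MvPowerSeries.subst ![(MvPowerSeries.X 0 : MvPowerSeries (Fin 2) R), MvPowerSeries.X 0]
        W.formalSlope =
      (d⁄dX R W.formalW).subst (MvPowerSeries.X 0 : MvPowerSeries (Fin 2) R) := by
  classical
  have hs : MvPowerSeries.HasSubst
      ![(MvPowerSeries.X 0 : MvPowerSeries (Fin 2) R), MvPowerSeries.X 0] :=
    MvPowerSeries.hasSubst_of_constantCoeff_zero fun i => by fin_cases i <;> simp
  ext d
  rw [MvPowerSeries.coeff_subst hs, coeff_powerSeries_subst_X, coeff_derivative]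
  -- the monomial `∏ₛ (X 0)^{e s} = (X 0)^{e 0 + e 1}`
  have hmon : ∀ e : Fin 2 →₀ ℕ, (e.prod fun s n =>
      (![(MvPowerSeries.X 0 : MvPowerSeries (Fin 2) R), MvPowerSeries.X 0] s) ^ n) =
      (MvPowerSeries.X 0) ^ (e 0 + e 1) := by
    intro e
    rw [finsupp_prod_pow_fin_two]
    simp [pow_add]
  simp_rw [hmon, MvPowerSeries.coeff_X_pow, smul_eq_mul, mul_ite, mul_one, mul_zero]
  by_cases hd : d = Finsupp.single 0 (d 0)
  · rw [if_pos hd]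
    -- sum over `e` with `e 0 + e 1 = d 0` of `coeff (e 0 + e 1 + 1) w`
    have hsupp : (Function.support fun e : Fin 2 →₀ ℕ =>
        if d = Finsupp.single 0 (e 0 + e 1) then MvPowerSeries.coeff e W.formalSlope else 0) ⊆
        ((Finset.antidiagonal (d 0)).image
          fun ij : ℕ × ℕ => Finsupp.single 0 ij.1 + Finsupp.single 1 ij.2 : Finset (Fin 2 →₀ ℕ)) := by
      intro e he
      simp only [Function.mem_support, ne_eq, ite_eq_right_iff, Classical.not_imp] at he
      simp only [Finset.coe_image, Set.mem_image, Finset.mem_coe, Finset.mem_antidiagonal,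
        Prod.exists]
      refine ⟨e 0, e 1, ?_, (finsupp_fin_two_eq e).symm⟩
      have := congrArg (fun f : Fin 2 →₀ ℕ => f 0) he.1
      simp only [Finsupp.single_eq_same] at this
      rw [hd] at this; simpa using this.symm
    rw [finsum_eq_sum_of_support_subset _ hsupp, Finset.sum_image]
    · have : ∀ ij ∈ Finset.antidiagonal (d 0),
          (if d = Finsupp.single 0 ((Finsupp.single 0 ij.1 + Finsupp.single 1 ij.2 : Fin 2 →₀ ℕ) 0 +
            (Finsupp.single 0 ij.1 + Finsupp.single 1 ij.2 : Fin 2 →₀ ℕ) 1)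
          then MvPowerSeries.coeff (Finsupp.single 0 ij.1 + Finsupp.single 1 ij.2) W.formalSlope
          else 0) = coeff (d 0 + 1) W.formalW := by
        intro ij hij
        rw [Finset.mem_antidiagonal] at hij
        have e0 : (Finsupp.single 0 ij.1 + Finsupp.single 1 ij.2 : Fin 2 →₀ ℕ) 0 = ij.1 := by simp
        have e1 : (Finsupp.single 0 ij.1 + Finsupp.single 1 ij.2 : Fin 2 →₀ ℕ) 1 = ij.2 := by simp
        rw [e0, e1, hij, if_pos hd]
        show coeff ((Finsupp.single 0 ij.1 + Finsupp.single 1 ij.2 : Fin 2 →₀ ℕ) 0 +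
          (Finsupp.single 0 ij.1 + Finsupp.single 1 ij.2 : Fin 2 →₀ ℕ) 1 + 1) W.formalW = _
        rw [e0, e1, hij]
      rw [Finset.sum_congr rfl this, Finset.sum_const, Finset.Nat.card_antidiagonal, nsmul_eq_mul,
        mul_comm]
      push_cast; ring
    · intro ij _ kl _ h
      have h0 := congrArg (fun f : Fin 2 →₀ ℕ => f 0) h
      have h1 := congrArg (fun f : Fin 2 →₀ ℕ => f 1) h
      simp only [Finsupp.coe_add, Pi.add_apply, Finsupp.single_eq_same, Finsupp.single_eq_of_ne
        (show (0 : Fin 2) ≠ 1 by decide), Finsupp.single_eq_of_ne (show (1 : Fin 2) ≠ 0 by decide),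
        add_zero, zero_add] at h0 h1
      exact Prod.ext h0 h1
  · rw [if_neg hd]
    apply finsum_eq_zero_of_forall_eq_zero
    intro e
    rw [if_neg]
    intro h
    apply hd
    have := congrArg (fun f : Fin 2 →₀ ℕ => f 0) h
    simp only [Finsupp.single_eq_same] at this
    rw [← this] at h; exact h

end FormalDerivative

/-! ### Pointwise values of `λ, ν, z₃, F` at a pair of points of the open unit disc -/

section Pointwise

variable {p : ℕ} [Fact p.Prime] (V : WeierstrassCurve ℚ_[p]) [hV : V.IsIntegral ℤ_[p]]

/-- `λ ∈ ℤ_p⟦z₁, z₂⟧`. [folklore] -/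
theorem isPadicInt_formalSlope : IsPadicInt V.formalSlope := by
  rw [isPadicInt_iff_exists_map]
  exact ⟨(V.integralModel ℤ_[p]).formalSlope, by rw [map_formalSlope, eq_map_integralModel]⟩

/-- `ν ∈ ℤ_p⟦z₁, z₂⟧`. [folklore] -/
theorem isPadicInt_formalIntercept : IsPadicInt V.formalIntercept := by
  rw [isPadicInt_iff_exists_map]
  exact ⟨(V.integralModel ℤ_[p]).formalIntercept, by rw [map_formalIntercept, eq_map_integralModel]⟩

/-- The denominator is integral. [folklore] -/
theorem isPadicInt_formalChordDenom : IsPadicInt V.formalChordDenom := by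
  rw [isPadicInt_iff_exists_map]
  exact ⟨(V.integralModel ℤ_[p]).formalChordDenom, by rw [map_formalChordDenom, eq_map_integralModel]⟩

/-- The numerator is integral. [folklore] -/
theorem isPadicInt_formalChordNum : IsPadicInt V.formalChordNum := by
  rw [isPadicInt_iff_exists_map]
  exact ⟨(V.integralModel ℤ_[p]).formalChordNum, by rw [map_formalChordNum, eq_map_integralModel]⟩

/-- The inverse of the denominator is integral. [folklore] -/
theorem isPadicInt_invOfUnit_formalChordDenom :
    IsPadicInt (MvPowerSeries.invOfUnit V.formalChordDenom 1) := by
  rw [isPadicInt_iff_exists_map]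
  refine ⟨MvPowerSeries.invOfUnit (V.integralModel ℤ_[p]).formalChordDenom 1, ?_⟩
  rw [mvPowerSeries_map_invOfUnit_one _ _ (constantCoeff_formalChordDenom _), map_formalChordDenom,
    eq_map_integralModel]

/-- `w'(z) ∈ ℤ_p⟦z⟧`. [folklore] -/
theorem isPadicInt_derivative_formalW : IsPadicInt (d⁄dX ℚ_[p] V.formalW) := by
  rw [isPadicInt_iff_exists_powerSeries_map]
  exact ⟨d⁄dX ℤ_[p] (V.integralModel ℤ_[p]).formalW, by
    rw [← derivative_map, map_formalW, eq_map_integralModel]⟩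

omit hV in
/-- Inverses evaluate to inverses, two variables: `F·G = 1 ⇒ G(u,v) = F(u,v)⁻¹`. [folklore] -/
theorem _root_.Literature.NumberTheory.EllipticCurves.padicEval₂_eq_inv_of_mul_eq_one
    {F G : MvPowerSeries (Fin 2) ℚ_[p]} (hF : IsPadicInt F) (hG : IsPadicInt G) (hFG : F * G = 1)
    {u v : ℚ_[p]} (hu : ‖u‖ < 1) (hv : ‖v‖ < 1) : padicEval₂ G u v = (padicEval₂ F u v)⁻¹ := by
  have h := padicEval₂_mul hF hG hu hv
  rw [hFG, ← map_one (MvPowerSeries.C (σ := Fin 2) (R := ℚ_[p])), padicEval₂_C] at h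
  exact eq_inv_of_mul_eq_one_right h.symm

variable {V}
variable {u v : ℚ_[p]} (hu : ‖u‖ < 1) (hv : ‖v‖ < 1)
include hu hv

/-- **Chord property at points**: `λ(u,v)·(v - u) = w(v) - w(u)`. [Silverman AEC IV.1] [folklore] -/
theorem padicEval₂_formalSlope_mul_sub :
    padicEval₂ V.formalSlope u v * (v - u) = padicEval V.formalW v - padicEval V.formalW u := by
  have h := congrArg (fun G => padicEval₂ G u v) V.formalSlope_mul_sub
  rwa [padicEval₂_mul V.isPadicInt_formalSlope ((IsPadicInt.X 1).sub (IsPadicInt.X 0)) hu hv,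
    padicEval₂_sub (IsPadicInt.X 1) (IsPadicInt.X 0) hu hv, padicEval₂_X, padicEval₂_X,
    padicEval₂_sub (V.isPadicInt_formalW.powerSeries_subst (IsPadicInt.X 1) (PowerSeries.HasSubst.X 1))
      (V.isPadicInt_formalW.powerSeries_subst (IsPadicInt.X 0) (PowerSeries.HasSubst.X 0)) hu hv,
    padicEval₂_subst_X V.isPadicInt_formalW hu hv, padicEval₂_subst_X V.isPadicInt_formalW hu hv] at h

/-- **Intercept at points**: `ν(u,v) = w(u) - λ(u,v)·u`. [Silverman AEC IV.1] [folklore] -/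
theorem padicEval₂_formalIntercept :
    padicEval₂ V.formalIntercept u v = padicEval V.formalW u - padicEval₂ V.formalSlope u v * u := by
  unfold formalIntercept
  rw [padicEval₂_sub (V.isPadicInt_formalW.powerSeries_subst (IsPadicInt.X 0)
      (PowerSeries.HasSubst.X 0)) (V.isPadicInt_formalSlope.mul (IsPadicInt.X 0)) hu hv,
    padicEval₂_subst_X V.isPadicInt_formalW hu hv, padicEval₂_mul V.isPadicInt_formalSlope
      (IsPadicInt.X 0) hu hv, padicEval₂_X]
  rfl

/-- The denominator at points: `1 + a₂λ̂ + a₄λ̂² + a₆λ̂³`. [folklore] -/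
theorem padicEval₂_formalChordDenom :
    padicEval₂ V.formalChordDenom u v = 1 + V.a₂ * padicEval₂ V.formalSlope u v +
      V.a₄ * padicEval₂ V.formalSlope u v ^ 2 + V.a₆ * padicEval₂ V.formalSlope u v ^ 3 := by
  obtain ⟨-, h₂, -, h₄, h₆⟩ := V.norm_coeffs_le_one
  have hl := V.isPadicInt_formalSlope
  unfold formalChordDenom
  rw [padicEval₂_add ((IsPadicInt.one.add ((IsPadicInt.C h₂).mul hl)).add ((IsPadicInt.C h₄).mul
      (hl.pow 2))) ((IsPadicInt.C h₆).mul (hl.pow 3)) hu hv,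
    padicEval₂_add (IsPadicInt.one.add ((IsPadicInt.C h₂).mul hl)) ((IsPadicInt.C h₄).mul
      (hl.pow 2)) hu hv,
    padicEval₂_add IsPadicInt.one ((IsPadicInt.C h₂).mul hl) hu hv,
    padicEval₂_mul (IsPadicInt.C h₂) hl hu hv, padicEval₂_mul (IsPadicInt.C h₄) (hl.pow 2) hu hv,
    padicEval₂_mul (IsPadicInt.C h₆) (hl.pow 3) hu hv, padicEval₂_pow hl hu hv,
    padicEval₂_pow hl hu hv, padicEval₂_C, padicEval₂_C, padicEval₂_C,
    ← map_one (MvPowerSeries.C (σ := Fin 2) (R := ℚ_[p])), padicEval₂_C]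

/-- The numerator at points: `a₁λ̂ + a₂ν̂ + a₃λ̂² + 2a₄λ̂ν̂ + 3a₆λ̂²ν̂`. [folklore] -/
theorem padicEval₂_formalChordNum :
    padicEval₂ V.formalChordNum u v =
      V.a₁ * padicEval₂ V.formalSlope u v + V.a₂ * padicEval₂ V.formalIntercept u v +
      V.a₃ * padicEval₂ V.formalSlope u v ^ 2 +
      2 * V.a₄ * padicEval₂ V.formalSlope u v * padicEval₂ V.formalIntercept u v +
      3 * V.a₆ * padicEval₂ V.formalSlope u v ^ 2 * padicEval₂ V.formalIntercept u v := by
  obtain ⟨h₁, h₂, h₃, h₄, h₆⟩ := V.norm_coeffs_le_one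
  have hl := V.isPadicInt_formalSlope
  have hn := V.isPadicInt_formalIntercept
  have h2 : IsPadicInt (2 : MvPowerSeries (Fin 2) ℚ_[p]) := by
    rw [show (2 : MvPowerSeries (Fin 2) ℚ_[p]) = 1 + 1 by norm_num]; exact IsPadicInt.one.add IsPadicInt.one
  have h3 : IsPadicInt (3 : MvPowerSeries (Fin 2) ℚ_[p]) := by
    rw [show (3 : MvPowerSeries (Fin 2) ℚ_[p]) = 1 + 1 + 1 by norm_num]
    exact (IsPadicInt.one.add IsPadicInt.one).add IsPadicInt.one
  have e2 : padicEval₂ (2 : MvPowerSeries (Fin 2) ℚ_[p]) u v = 2 := by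
    rw [show (2 : MvPowerSeries (Fin 2) ℚ_[p]) = MvPowerSeries.C 2 by rw [map_ofNat], padicEval₂_C]
  have e3 : padicEval₂ (3 : MvPowerSeries (Fin 2) ℚ_[p]) u v = 3 := by
    rw [show (3 : MvPowerSeries (Fin 2) ℚ_[p]) = MvPowerSeries.C 3 by rw [map_ofNat], padicEval₂_C]
  have t1 := (IsPadicInt.C h₁).mul hl
  have t2 := (IsPadicInt.C h₂).mul hn
  have t3 := (IsPadicInt.C h₃).mul (hl.pow 2)
  have t4 := ((h2.mul (IsPadicInt.C h₄)).mul hl).mul hn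
  have t5 := ((h3.mul (IsPadicInt.C h₆)).mul (hl.pow 2)).mul hn
  unfold formalChordNum
  rw [padicEval₂_add (((t1.add t2).add t3).add t4) t5 hu hv,
    padicEval₂_add ((t1.add t2).add t3) t4 hu hv, padicEval₂_add (t1.add t2) t3 hu hv,
    padicEval₂_add t1 t2 hu hv,
    padicEval₂_mul (IsPadicInt.C h₁) hl hu hv, padicEval₂_mul (IsPadicInt.C h₂) hn hu hv,
    padicEval₂_mul (IsPadicInt.C h₃) (hl.pow 2) hu hv,
    padicEval₂_mul ((h2.mul (IsPadicInt.C h₄)).mul hl) hn hu hv,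
    padicEval₂_mul (h2.mul (IsPadicInt.C h₄)) hl hu hv, padicEval₂_mul h2 (IsPadicInt.C h₄) hu hv,
    padicEval₂_mul ((h3.mul (IsPadicInt.C h₆)).mul (hl.pow 2)) hn hu hv,
    padicEval₂_mul (h3.mul (IsPadicInt.C h₆)) (hl.pow 2) hu hv, padicEval₂_mul h3 (IsPadicInt.C h₆) hu hv,
    padicEval₂_pow hl hu hv, padicEval₂_C, padicEval₂_C, padicEval₂_C, padicEval₂_C, padicEval₂_C,
    e2, e3]

/-- **The third root at points**: `z₃(u,v) = -u - v - N̂/D̂`. [Silverman AEC IV.1] [folklore] -/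
theorem padicEval₂_formalChordZ :
    padicEval₂ V.formalChordZ u v =
      -u - v - padicEval₂ V.formalChordNum u v * (padicEval₂ V.formalChordDenom u v)⁻¹ := by
  have hD := V.isPadicInt_formalChordDenom
  have hDi := V.isPadicInt_invOfUnit_formalChordDenom
  have hN := V.isPadicInt_formalChordNum
  have hmul : V.formalChordDenom * MvPowerSeries.invOfUnit V.formalChordDenom 1 = 1 :=
    MvPowerSeries.mul_invOfUnit _ 1 (by rw [constantCoeff_formalChordDenom, Units.val_one])
  unfold formalChordZ
  rw [padicEval₂_sub ((IsPadicInt.X 0).neg.sub (IsPadicInt.X 1)) (hN.mul hDi) hu hv,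
    padicEval₂_sub (IsPadicInt.X 0).neg (IsPadicInt.X 1) hu hv, padicEval₂_neg (IsPadicInt.X 0) hu hv,
    padicEval₂_X, padicEval₂_X, padicEval₂_mul hN hDi hu hv,
    padicEval₂_eq_inv_of_mul_eq_one hD hDi hmul hu hv]
  rfl

/-- **The formal group law at points**: `F(u,v) = i(z₃(u,v))` (values). [Silverman AEC IV.1]
[folklore] -/
theorem padicEval₂_formalGroupLaw :
    padicEval₂ V.formalGroupLaw u v = padicEval V.formalNeg (padicEval₂ V.formalChordZ u v) := by
  unfold formalGroupLaw
  exact padicEval₂_subst V.isPadicInt_formalNeg V.isPadicInt_formalChordZ V.constantCoeff_formalChordZ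
    hu hv

omit hv in
/-- **`λ(u,u) = w'(u)` at points.** [Silverman AEC IV.1] [folklore] -/
theorem padicEval₂_formalSlope_diag :
    padicEval₂ V.formalSlope u u = padicEval (d⁄dX ℚ_[p] V.formalW) u := by
  have h := congrArg (fun G => padicEval₂ G u u) V.formalSlope_diag
  rwa [padicEval₂_substPair V.isPadicInt_formalSlope (IsPadicInt.X 0) (IsPadicInt.X 0)
    (MvPowerSeries.constantCoeff_X 0) (MvPowerSeries.constantCoeff_X 0) hu hu, padicEval₂_X,
    padicEval₂_subst_X V.isPadicInt_derivative_formalW hu hu] at h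

end Pointwise

/-! ### The derivative `w'` at a point of `E₁(ℚ_p)` -/

section DerivativeAtPoint

variable {p : ℕ} [Fact p.Prime] (V : WeierstrassCurve ℚ_[p]) [hV : V.IsIntegral ℤ_[p]]

omit hV in
/-- The implicit-differentiation identity evaluated on the `ℤ_p`-side. [folklore] -/
theorem evalHom_derivative_formalW (V : WeierstrassCurve ℤ_[p]) (t : ℤ_[p]) (ht : ‖t‖ < 1) :
    evalHom t ht (d⁄dX ℤ_[p] V.formalW) =
      (3 * t ^ 2 + V.a₁ * evalHom t ht V.formalW + 2 * V.a₂ * t * evalHom t ht V.formalW +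
          V.a₄ * evalHom t ht V.formalW ^ 2) +
        (V.a₁ * t + V.a₂ * t ^ 2 + 2 * V.a₃ * evalHom t ht V.formalW +
            2 * V.a₄ * t * evalHom t ht V.formalW + 3 * V.a₆ * evalHom t ht V.formalW ^ 2) *
          evalHom t ht (d⁄dX ℤ_[p] V.formalW) := by
  have hX : evalHom t ht X = t := by rw [evalHom_apply, PowerSeries.eval₂_X]
  have hC : ∀ a : ℤ_[p], evalHom t ht (C a) = a := fun a => by
    rw [evalHom_apply, PowerSeries.eval₂_C, RingHom.id_apply]
  conv_lhs => rw [V.derivative_formalW]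
  simp only [map_add, map_mul, map_pow, hX, hC, map_ofNat]

/-- **`w'(z(P))·(1 - f̂_w) = f̂_z`** at `P = (x, y) ∈ E₁(ℚ_p)`, with `w(z(P)) = -1/y` inserted:
writing `u = z(P)`, `w = -1/y`, `ŵ' = w'(u)`,
`ŵ' = (3u² + a₁w + 2a₂uw + a₄w²) + (a₁u + a₂u² + 2a₃w + 2a₄uw + 3a₆w²)·ŵ'`.
[Silverman AEC IV.1] [folklore] -/
theorem padicEval_derivative_formalW_eq {x y : ℚ_[p]} (heq : V.toAffine.Equation x y) (hx : 1 < ‖x‖) :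
    padicEval (d⁄dX ℚ_[p] V.formalW) (-x / y) =
      (3 * (-x / y) ^ 2 + V.a₁ * (-1 / y) + 2 * V.a₂ * (-x / y) * (-1 / y) + V.a₄ * (-1 / y) ^ 2) +
        (V.a₁ * (-x / y) + V.a₂ * (-x / y) ^ 2 + 2 * V.a₃ * (-1 / y) +
            2 * V.a₄ * (-x / y) * (-1 / y) + 3 * V.a₆ * (-1 / y) ^ 2) *
          padicEval (d⁄dX ℚ_[p] V.formalW) (-x / y) := by
  obtain ⟨-, -, hz1, -, -⟩ := V.param_facts heq hx
  obtain ⟨z', hz', hz1'⟩ := exists_coe_eq_of_norm_lt_one hz1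
  set U := V.integralModel ℤ_[p]
  have hU := V.eq_map_integralModel
  have hw : padicEval V.formalW (-x / y) = (evalHom z' hz1' U.formalW : ℤ_[p]) := by
    rw [← hz', ← padicEval_map U.formalW hz1', map_formalW, hU]
  have hd : padicEval (d⁄dX ℚ_[p] V.formalW) (-x / y) = (evalHom z' hz1' (d⁄dX ℤ_[p] U.formalW) : ℤ_[p]) := by
    rw [← hz', ← padicEval_map _ hz1', ← derivative_map, map_formalW, hU]
  have key := congrArg ((↑) : ℤ_[p] → ℚ_[p]) (evalHom_derivative_formalW U z' hz1')
  push_cast at key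
  rw [← hd, ← hw, V.padicEval_formalW_eq heq hx, hz'] at key
  have ha₁ : (U.a₁ : ℚ_[p]) = V.a₁ := by rw [← hU, map_a₁]; rfl
  have ha₂ : (U.a₂ : ℚ_[p]) = V.a₂ := by rw [← hU, map_a₂]; rfl
  have ha₃ : (U.a₃ : ℚ_[p]) = V.a₃ := by rw [← hU, map_a₃]; rfl
  have ha₄ : (U.a₄ : ℚ_[p]) = V.a₄ := by rw [← hU, map_a₄]; rfl
  have ha₆ : (U.a₆ : ℚ_[p]) = V.a₆ := by rw [← hU, map_a₆]; rfl
  rw [ha₁, ha₂, ha₃, ha₄, ha₆] at key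
  exact key

/-- **The derivative dictionary**: at `P = (x, y) ∈ E₁(ℚ_p)`, `ŵ' = w'(z(P))` satisfies
`ŵ'·(z(P)·F_x - F_y) = w(P)·F_x` with `F_x = a₁y - 3x² - 2a₂x - a₄`, `F_y = 2y + a₁x + a₃`,
`w(P) = -1/y` (the slope `dw/dz` of the curve in the `(z,w)`-chart expressed through the
gradient in the `(x,y)`-chart). [Silverman AEC IV.1] [folklore] -/
theorem padicEval_derivative_formalW_mul {x y : ℚ_[p]} (heq : V.toAffine.Equation x y)
    (hx : 1 < ‖x‖) :
    padicEval (d⁄dX ℚ_[p] V.formalW) (-x / y) *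
        ((-x / y) * (V.a₁ * y - 3 * x ^ 2 - 2 * V.a₂ * x - V.a₄) - (2 * y + V.a₁ * x + V.a₃)) =
      (-1 / y) * (V.a₁ * y - 3 * x ^ 2 - 2 * V.a₂ * x - V.a₄) := by
  obtain ⟨hy0, -, -, -, -⟩ := V.param_facts heq hx
  have hd := V.padicEval_derivative_formalW_eq heq hx
  set D := padicEval (d⁄dX ℚ_[p] V.formalW) (-x / y) with hDdef
  rw [Affine.equation_iff] at heq
  field_simp
  field_simp at hd
  linear_combination hd - (3 : ℚ_[p]) * D * heq

end DerivativeAtPoint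

/-! ### The algebraic core: three collinear points in the `(x,y)`-chart give Vieta's
relation in the `(z,w)`-chart -/

section ChartTransfer

variable {k : Type*} [Field k] (W : WeierstrassCurve k)

/-- **The chart identity**: the `(z,w)`-equation is the `(x,y)`-equation divided by `y³`:
`f(z, w) - w = -w³ · F(z/w, -1/w)` for `w ≠ 0`, where
`f(z,w) = z³ + a₁zw + a₂z²w + a₃w² + a₄zw² + a₆w³` and
`F(x,y) = y² + a₁xy + a₃y - (x³ + a₂x² + a₄x + a₆)`. [Silverman AEC IV.1 (p. 115, "dividing
the Weierstrass equation by `y³`")] [folklore] -/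
theorem chart_identity (z w : k) (hw : w ≠ 0) :
    z ^ 3 + W.a₁ * z * w + W.a₂ * z ^ 2 * w + W.a₃ * w ^ 2 + W.a₄ * z * w ^ 2 + W.a₆ * w ^ 3 - w =
      -w ^ 3 * ((-1 / w) ^ 2 + W.a₁ * (z / w) * (-1 / w) + W.a₃ * (-1 / w) -
        ((z / w) ^ 3 + W.a₂ * (z / w) ^ 2 + W.a₄ * (z / w) + W.a₆)) := by
  field_simp
  ring

/-- **Chart transfer of the chord factorisation.** Let `w = λT + ν` be a line in the
`(z,w)`-plane with `ν ≠ 0`, corresponding to the line `y = (λ/ν)(x - x₁) + y₁` of the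
`(x,y)`-plane through a point with `νy₁ = λx₁ - 1`. If the Weierstrass polynomial restricted to
the `(x,y)`-line factors as `-(X - x₁)(X - x₂)(X - x₃)` (Mathlib's `addPolynomial_slope`), then
the cubic in `T` cut out by the `(z,w)`-line, `f(T, λT+ν) - (λT+ν) = c₃T³ + c₂T² + ⋯`, has
`c₃ = ∏ (1 - λxᵢ)` and `c₂ = -Σᵢ νxᵢ ∏_{j≠i} (1 - λxⱼ)` (both sides are cubic polynomials in `T`
agreeing at the infinitely many `T` with `λT + ν ≠ 0`). [Silverman AEC IV.1 (pp. 116–117: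
"substituting this into the Weierstrass equation gives a cubic in `z`, two of whose roots are
`z₁` and `z₂`")] [folklore] -/
theorem chord_coeffs_of_xy_factorisation [Infinite k] {x₁ y₁ x₂ x₃ l ν : k} (hν : ν ≠ 0)
    (hP : ν * y₁ = l * x₁ - 1)
    (hfac : ∀ X : k,
      (l / ν * (X - x₁) + y₁) ^ 2 + W.a₁ * X * (l / ν * (X - x₁) + y₁) +
          W.a₃ * (l / ν * (X - x₁) + y₁) - (X ^ 3 + W.a₂ * X ^ 2 + W.a₄ * X + W.a₆) =
        -((X - x₁) * (X - x₂) * (X - x₃))) :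
    1 + W.a₂ * l + W.a₄ * l ^ 2 + W.a₆ * l ^ 3 = (1 - l * x₁) * (1 - l * x₂) * (1 - l * x₃) ∧
    W.a₁ * l + W.a₂ * ν + W.a₃ * l ^ 2 + 2 * W.a₄ * l * ν + 3 * W.a₆ * l ^ 2 * ν =
      -(ν * x₁ * (1 - l * x₂) * (1 - l * x₃) + (1 - l * x₁) * (ν * x₂) * (1 - l * x₃) +
        (1 - l * x₁) * (1 - l * x₂) * (ν * x₃)) := by
  -- names for the coefficients
  set c₃ := 1 + W.a₂ * l + W.a₄ * l ^ 2 + W.a₆ * l ^ 3 with hc₃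
  set c₂ := W.a₁ * l + W.a₂ * ν + W.a₃ * l ^ 2 + 2 * W.a₄ * l * ν + 3 * W.a₆ * l ^ 2 * ν with hc₂
  set c₁ := W.a₁ * ν + 2 * W.a₃ * l * ν + W.a₄ * ν ^ 2 + 3 * W.a₆ * l * ν ^ 2 - l with hc₁
  set c₀ := W.a₃ * ν ^ 2 + W.a₆ * ν ^ 3 - ν with hc₀
  set α := (1 - l * x₁) * (1 - l * x₂) * (1 - l * x₃) with hα
  set β := -(ν * x₁ * (1 - l * x₂) * (1 - l * x₃) + (1 - l * x₁) * (ν * x₂) * (1 - l * x₃) +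
    (1 - l * x₁) * (1 - l * x₂) * (ν * x₃)) with hβ
  set γ := ν * x₁ * (ν * x₂) * (1 - l * x₃) + ν * x₁ * (1 - l * x₂) * (ν * x₃) +
    (1 - l * x₁) * (ν * x₂) * (ν * x₃) with hγ
  set δ := -(ν * x₁ * (ν * x₂) * (ν * x₃)) with hδ
  -- the two cubics agree wherever `λT + ν ≠ 0`
  have hpt : ∀ T : k, l * T + ν ≠ 0 →
      c₃ * T ^ 3 + c₂ * T ^ 2 + c₁ * T + c₀ = α * T ^ 3 + β * T ^ 2 + γ * T + δ := by
    intro T hT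
    set w := l * T + ν with hwdef
    have hcubic : c₃ * T ^ 3 + c₂ * T ^ 2 + c₁ * T + c₀ =
        T ^ 3 + W.a₁ * T * w + W.a₂ * T ^ 2 * w + W.a₃ * w ^ 2 + W.a₄ * T * w ^ 2 +
          W.a₆ * w ^ 3 - w := by
      rw [hc₃, hc₂, hc₁, hc₀, hwdef]; ring
    have hline : l / ν * (T / w - x₁) + y₁ = -1 / w := by
      field_simp
      linear_combination (l * T + ν) * hP
    have hprod : α * T ^ 3 + β * T ^ 2 + γ * T + δ =
        ((1 - l * x₁) * T - ν * x₁) * ((1 - l * x₂) * T - ν * x₂) * ((1 - l * x₃) * T - ν * x₃) := by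
      rw [hα, hβ, hγ, hδ]; ring
    rw [hcubic, hprod, W.chart_identity T w hT, ← hline, hfac (T / w)]
    field_simp
    ring
  -- hence equal as polynomials
  set Q : Polynomial k := Polynomial.C (c₃ - α) * Polynomial.X ^ 3 +
    Polynomial.C (c₂ - β) * Polynomial.X ^ 2 + Polynomial.C (c₁ - γ) * Polynomial.X +
    Polynomial.C (c₀ - δ) with hQ
  have hQeval : ∀ T : k, Q.eval T = (c₃ * T ^ 3 + c₂ * T ^ 2 + c₁ * T + c₀) -
      (α * T ^ 3 + β * T ^ 2 + γ * T + δ) := by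
    intro T; simp only [hQ, Polynomial.eval_add, Polynomial.eval_mul, Polynomial.eval_C,
      Polynomial.eval_pow, Polynomial.eval_X]; ring
  have hfin : {T : k | l * T + ν = 0}.Finite := by
    refine (Set.finite_singleton (-ν / l)).subset fun T hT => ?_
    simp only [Set.mem_setOf_eq] at hT
    simp only [Set.mem_singleton_iff]
    have hl : l ≠ 0 := by rintro rfl; apply hν; simpa using hT
    field_simp; linear_combination hT
  have hinf : {T : k | Polynomial.IsRoot Q T}.Infinite := by
    refine (hfin.infinite_compl).mono fun T hT => ?_
    simp only [Set.mem_compl_iff, Set.mem_setOf_eq] at hT ⊢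
    rw [Polynomial.IsRoot.def, hQeval, hpt T hT, sub_self]
  have hQ0 : Q = 0 := Polynomial.eq_zero_of_infinite_isRoot Q hinf
  have h3 : Q.coeff 3 = c₃ - α := by
    rw [hQ]
    simp only [Polynomial.coeff_add, Polynomial.coeff_C_mul, Polynomial.coeff_X_pow,
      Polynomial.coeff_X, Polynomial.coeff_C]
    norm_num
  have h2 : Q.coeff 2 = c₂ - β := by
    rw [hQ]
    simp only [Polynomial.coeff_add, Polynomial.coeff_C_mul, Polynomial.coeff_X_pow,
      Polynomial.coeff_X, Polynomial.coeff_C]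
    norm_num
  rw [hQ0, Polynomial.coeff_zero] at h3 h2
  exact ⟨(sub_eq_zero.mp h3.symm), (sub_eq_zero.mp h2.symm)⟩

/-- **Vieta in the `(z,w)`-chart**: under the hypotheses of `chord_coeffs_of_xy_factorisation`,
if moreover all three points `(xᵢ, yᵢ)` have `yᵢ ≠ 0` and lie on the line (`νyᵢ = λxᵢ - 1`),
then their parameters `zᵢ = -xᵢ/yᵢ` satisfy `c₃ (z₁ + z₂ + z₃) = -c₂`. [Silverman AEC IV.1
(p. 117, "looking at the quadratic term … the third root")] [folklore] -/
theorem chord_vieta [Infinite k] {x₁ y₁ x₂ y₂ x₃ y₃ l ν : k} (hν : ν ≠ 0)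
    (hy₁ : y₁ ≠ 0) (hy₂ : y₂ ≠ 0) (hy₃ : y₃ ≠ 0)
    (hP : ν * y₁ = l * x₁ - 1) (hQ : ν * y₂ = l * x₂ - 1) (hR : ν * y₃ = l * x₃ - 1)
    (hfac : ∀ X : k,
      (l / ν * (X - x₁) + y₁) ^ 2 + W.a₁ * X * (l / ν * (X - x₁) + y₁) +
          W.a₃ * (l / ν * (X - x₁) + y₁) - (X ^ 3 + W.a₂ * X ^ 2 + W.a₄ * X + W.a₆) =
        -((X - x₁) * (X - x₂) * (X - x₃))) :
    (1 + W.a₂ * l + W.a₄ * l ^ 2 + W.a₆ * l ^ 3) * (-x₁ / y₁ + -x₂ / y₂ + -x₃ / y₃) =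
      -(W.a₁ * l + W.a₂ * ν + W.a₃ * l ^ 2 + 2 * W.a₄ * l * ν + 3 * W.a₆ * l ^ 2 * ν) := by
  obtain ⟨h3, h2⟩ := W.chord_coeffs_of_xy_factorisation hν hP hfac
  rw [h3, h2]
  have e₁ : 1 - l * x₁ = -(ν * y₁) := by linear_combination hP
  have e₂ : 1 - l * x₂ = -(ν * y₂) := by linear_combination hQ
  have e₃ : 1 - l * x₃ = -(ν * y₃) := by linear_combination hR
  rw [e₁, e₂, e₃]
  field_simp
  ring

/-- Non-vanishing of the leading coefficient pins down `y₃ ≠ 0`: if `c₃ ≠ 0` then the third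
intersection is an affine point of the `(z,w)`-chart. [folklore] -/
theorem y_ne_zero_of_chord_coeff_ne_zero [Infinite k] {x₁ y₁ x₂ x₃ y₃ l ν : k} (hν : ν ≠ 0)
    (hP : ν * y₁ = l * x₁ - 1) (hR : ν * y₃ = l * x₃ - 1)
    (hfac : ∀ X : k,
      (l / ν * (X - x₁) + y₁) ^ 2 + W.a₁ * X * (l / ν * (X - x₁) + y₁) +
          W.a₃ * (l / ν * (X - x₁) + y₁) - (X ^ 3 + W.a₂ * X ^ 2 + W.a₄ * X + W.a₆) =
        -((X - x₁) * (X - x₂) * (X - x₃)))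
    (hc₃ : 1 + W.a₂ * l + W.a₄ * l ^ 2 + W.a₆ * l ^ 3 ≠ 0) : y₃ ≠ 0 := by
  obtain ⟨h3, -⟩ := W.chord_coeffs_of_xy_factorisation hν hP hfac
  intro hy
  apply hc₃
  rw [h3, show 1 - l * x₃ = -(ν * y₃) by linear_combination hR, hy, mul_zero, neg_zero, mul_zero]

/-- A curve point in the `(z,w)`-chart: if `F(x, y) = 0` and `y ≠ 0` then `(z, w) = (-x/y, -1/y)`
satisfies `w = f(z, w)`. [Silverman AEC IV.1 (p. 115)] [folklore] -/
theorem chart_point {x y : k} (heq : W.toAffine.Equation x y) (hy : y ≠ 0) :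
    (-x / y) ^ 3 + W.a₁ * (-x / y) * (-1 / y) + W.a₂ * (-x / y) ^ 2 * (-1 / y) +
        W.a₃ * (-1 / y) ^ 2 + W.a₄ * (-x / y) * (-1 / y) ^ 2 + W.a₆ * (-1 / y) ^ 3 = -1 / y := by
  rw [Affine.equation_iff] at heq
  field_simp
  linear_combination heq

/-- **Root**: a point of the `(z,w)`-curve on the line `w = λz + ν` is a root of the chord cubic
`c₃T³ + c₂T² + c₁T + c₀`. [Silverman AEC IV.1 (p. 117)] [folklore] -/
theorem chord_cubic_root {z w l ν : k}
    (hcurve : z ^ 3 + W.a₁ * z * w + W.a₂ * z ^ 2 * w + W.a₃ * w ^ 2 + W.a₄ * z * w ^ 2 +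
      W.a₆ * w ^ 3 = w) (hline : w = l * z + ν) :
    (1 + W.a₂ * l + W.a₄ * l ^ 2 + W.a₆ * l ^ 3) * z ^ 3 +
      (W.a₁ * l + W.a₂ * ν + W.a₃ * l ^ 2 + 2 * W.a₄ * l * ν + 3 * W.a₆ * l ^ 2 * ν) * z ^ 2 +
      (W.a₁ * ν + 2 * W.a₃ * l * ν + W.a₄ * ν ^ 2 + 3 * W.a₆ * l * ν ^ 2 - l) * z +
      (W.a₃ * ν ^ 2 + W.a₆ * ν ^ 3 - ν) = 0 := by
  rw [hline] at hcurve
  linear_combination hcurve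

/-- **Vieta for a chord through the origin**: if `ν = 0` and `u ≠ v` are non-zero roots of the
chord cubic (which is then `T·(c₃T² + c₂T - λ)`), then `c₃(u + v) + c₂ = 0`. [folklore] -/
theorem chord_origin_vieta {u v l : k} (hu : u ≠ 0) (hv : v ≠ 0) (huv : u ≠ v)
    (hru : (1 + W.a₂ * l + W.a₄ * l ^ 2 + W.a₆ * l ^ 3) * u ^ 3 +
      (W.a₁ * l + W.a₃ * l ^ 2) * u ^ 2 + (-l) * u = 0)
    (hrv : (1 + W.a₂ * l + W.a₄ * l ^ 2 + W.a₆ * l ^ 3) * v ^ 3 +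
      (W.a₁ * l + W.a₃ * l ^ 2) * v ^ 2 + (-l) * v = 0) :
    (1 + W.a₂ * l + W.a₄ * l ^ 2 + W.a₆ * l ^ 3) * (u + v) + (W.a₁ * l + W.a₃ * l ^ 2) = 0 := by
  set c₃ := 1 + W.a₂ * l + W.a₄ * l ^ 2 + W.a₆ * l ^ 3
  set c₂ := W.a₁ * l + W.a₃ * l ^ 2
  have hu' : c₃ * u ^ 2 + c₂ * u - l = 0 := by
    have : u * (c₃ * u ^ 2 + c₂ * u - l) = 0 := by linear_combination hru
    exact (mul_eq_zero.mp this).resolve_left hu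
  have hv' : c₃ * v ^ 2 + c₂ * v - l = 0 := by
    have : v * (c₃ * v ^ 2 + c₂ * v - l) = 0 := by linear_combination hrv
    exact (mul_eq_zero.mp this).resolve_left hv
  have : (u - v) * (c₃ * (u + v) + c₂) = 0 := by linear_combination hu' - hv'
  exact (mul_eq_zero.mp this).resolve_left (sub_ne_zero.mpr huv)

/-- **Double root for a tangent through the origin**: if `ν = 0`, `u ≠ 0` is a root of the chord
cubic and the slope is the derivative (`λ·(1 - f_w(u, λu)) = f_z(u, λu)`), then `u` is a double
root: `2c₃u + c₂ = 0`. [folklore] -/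
theorem chord_origin_double {u l : k} (hu : u ≠ 0)
    (hru : (1 + W.a₂ * l + W.a₄ * l ^ 2 + W.a₆ * l ^ 3) * u ^ 3 +
      (W.a₁ * l + W.a₃ * l ^ 2) * u ^ 2 + (-l) * u = 0)
    (hder : l * (1 - (W.a₁ * u + W.a₂ * u ^ 2 + 2 * W.a₃ * (l * u) + 2 * W.a₄ * u * (l * u) +
      3 * W.a₆ * (l * u) ^ 2)) =
      3 * u ^ 2 + W.a₁ * (l * u) + 2 * W.a₂ * u * (l * u) + W.a₄ * (l * u) ^ 2) :
    2 * (1 + W.a₂ * l + W.a₄ * l ^ 2 + W.a₆ * l ^ 3) * u + (W.a₁ * l + W.a₃ * l ^ 2) = 0 := by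
  set c₃ := 1 + W.a₂ * l + W.a₄ * l ^ 2 + W.a₆ * l ^ 3 with hc₃
  set c₂ := W.a₁ * l + W.a₃ * l ^ 2 with hc₂
  have hu' : c₃ * u ^ 2 + c₂ * u - l = 0 := by
    have : u * (c₃ * u ^ 2 + c₂ * u - l) = 0 := by linear_combination hru
    exact (mul_eq_zero.mp this).resolve_left hu
  -- the derivative of the cubic at `u` vanishes
  have hd : 3 * c₃ * u ^ 2 + 2 * c₂ * u - l = 0 := by
    rw [hc₃, hc₂]; linear_combination (-1 : k) * hder
  have : u * (2 * c₃ * u + c₂) = 0 := by linear_combination hd - hu'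
  exact (mul_eq_zero.mp this).resolve_left hu

end ChartTransfer

end WeierstrassCurve
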